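import Literature.AnabelianGeometry.EtaleTheta.Discharge.Sec1Thm16GKN
import Literature.AnabelianGeometry.EtaleTheta.Discharge.Sec1HomIntConsequences
import HarnessLib

/-!
# [EtTh] Thm 1.6 (i): the sub-DAG input «a cuspidal decomposition group inside `Π^tp_Y`» is just «`X^log` has
# a cusp» (every decomposition group lies in `Π^tp_Y`, `Sec1HomIntConsequences`)

Mochizuki, *The étale theta function …*, Publ. RIMS **45** (2009), §1 p. 12–13 (type `(1,1)`: `X^log` has one
cusp; `Π^tp_Y = Ker(Π^tp_X ↠ Z)`), Thm. 1.6 (i) p. 24 [cite: MochizukiEtTh2009, Thm 1.6 (i) p.24]. Cell abc-iut,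
seat abc-iut-w6-d092 (gen 4); PROOF-ONLY (0 `def`). The Thm. 1.6 (i) assembly of abc-iut-w5-d051 / abc-iut-L6-d5
(`Thm16Sub.thm16i_of_isKernelOfAction`, `Sec1Thm16GKN`) and its L2/L6 consumers (`Sec2Cor218iModel`,
`EtaleThetaDataOfSettingThm16`, `BadPlaceSettingProp21OfThm16Inputs`, `ModelMonoThetaCor110Thm16`,
`ModelReconstructionInvarianceTateThm16`, `MonoThetaProjectiveThm16Facts`) carry the binder
`hex : ∃ Dc, D.IsCuspidalDecompositionGroup Dc ∧ Dc ≤ D.GtpY`. Since EVERY decomposition group of a closed point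
lies in `Π^tp_Y` (`ThetaSetting.exists_cuspidal_le_GtpY_of_exists_cusp`, from «Hom(profinite, ℤ) = 0»), that
binder is equivalent to the (P2)-shaped «`∃ x, D.IsCusp x`»; this file records the equivalence and the re-keyed
Thm. 1.6 (i). Nothing of the owners' files is edited. HONEST FRAMING: bookkeeping over the typed interfaces; no
side taken on [IUTchIII] Cor. 3.12; typed ≠ proved elsewhere.
-/

namespace Literature.AnabelianGeometry.EtaleTheta

open Literature.AnabelianGeometry.SemiGraphs Topology

variable {p : ℕ} [Fact p.Prime]

namespace ThetaSetting

variable (D : ThetaSetting p)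

/-- **«a cuspidal decomposition group inside `Π^tp_Y`» ⟺ «`X^log` has a cusp»** (the forward direction is
trivial; the backward one is `exists_cuspidal_le_GtpY_of_exists_cusp`). [cite: MochizukiEtTh2009, §1 p.13] -/
theorem exists_cuspidal_le_GtpY_iff_exists_cusp :
    (∃ Dc : Subgroup D.PiTemp, D.IsCuspidalDecompositionGroup Dc ∧ Dc ≤ D.GtpY) ↔ ∃ x : D.Pt, D.IsCusp x :=
  ⟨fun ⟨_, ⟨x, hx, _, _⟩, _⟩ => ⟨x, hx⟩, D.exists_cuspidal_le_GtpY_of_exists_cusp⟩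

/-- The Thm. 1.6 (i) cusp input from a `OncePuncturedData` parameter bundle (its (P2) `exists_cusp`).
[cite: MochizukiEtTh2009, §1 p.13] -/
theorem OncePuncturedData.exists_cuspidal_le_GtpY (e : D.OncePuncturedData) :
    ∃ Dc : Subgroup D.PiTemp, D.IsCuspidalDecompositionGroup Dc ∧ Dc ≤ D.GtpY :=
  D.exists_cuspidal_le_GtpY_of_exists_cusp e.exists_cusp

end ThetaSetting

namespace Thm16Sub

variable {Dα Dβ : ThetaSetting p} (γ : Dα.PiTemp ≃ₜ* Dβ.PiTemp)
  (hΔ : Dα.DeltaTemp.map γ.toMulEquiv.toMonoidHom = Dβ.DeltaTemp)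

include hΔ in
/-- **Thm. 1.6 (i) from the printed inputs, cusp input in (P2) form**: as abc-iut-L6-d5 / abc-iut-w5-d051's
`thm16i_of_isKernelOfAction`, with «a cuspidal decomposition group inside `Π^tp_{Yα}`» replaced by «`X^log_α` has a
cusp». [cite: MochizukiEtTh2009, Thm 1.6 (i) p.24] -/
theorem thm16i_of_isKernelOfAction_of_exists_cusp (hZα : KerToZIsCompactlyGenerated Dα)
    (hZβ : KerToZIsCompactlyGenerated Dβ) (hKα : GKNIsKernelOfAction Dα 2)
    (hKβ : GKNIsKernelOfAction Dβ 2) (hcuspα : GtpYNFromCusp Dα 2) (hcuspβ : GtpYNFromCusp Dβ 2)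
    (h65 : Dα.IsoPreservesCuspidalDecomp Dβ.toTemperedCurve) (hex : ∃ x : Dα.Pt, Dα.IsCusp x) :
    ThetaSetting.Thm16i γ :=
  thm16i_of_isKernelOfAction γ hΔ hZα hZβ hKα hKβ hcuspα hcuspβ h65
    (Dα.exists_cuspidal_le_GtpY_of_exists_cusp hex)

end Thm16Sub

namespace ThetaSetting

variable (D : ThetaSetting p)

/-- **Π^tp_Ÿ is characteristic under the Thm. 1.6 (i) inputs, cusp input in (P2) form** (abc-iut-L2-d1's
`map_GtpYdd_eq_of_thm16Inputs`, `Sec2Cor218iModel`, re-keyed). [cite: MochizukiEtTh2009, Thm 1.6 (i) p.24] -/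
theorem map_GtpYdd_eq_of_thm16Inputs_of_exists_cusp (Γ : D.PiTemp ≃ₜ* D.PiTemp)
    (hΔ : D.DeltaTemp.map Γ.toMulEquiv.toMonoidHom = D.DeltaTemp)
    (hZ : Thm16Sub.KerToZIsCompactlyGenerated D) (hK : Thm16Sub.GKNIsKernelOfAction D 2)
    (hYN : Thm16Sub.GtpYNFromCusp D 2) (h65 : D.IsoPreservesCuspidalDecomp D.toTemperedCurve)
    (hex : ∃ x : D.Pt, D.IsCusp x) : D.GtpYdd.map Γ.toMulEquiv.toMonoidHom = D.GtpYdd :=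
  Thm16Sub.thm16i_of_isKernelOfAction_of_exists_cusp (γ := Γ) (hΔ := hΔ) hZ hZ hK hK hYN hYN h65 hex

end ThetaSetting

end Literature.AnabelianGeometry.EtaleTheta
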